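import Literature.InformationTheory.QuantumCodes.ExpanderCodeDistance
import Literature.InformationTheory.QuantumCodes.HypergraphProductDistance
import Literature.InformationTheory.QuantumCodes.HypergraphProductDimension
import Literature.InformationTheory.QuantumCodes.HypergraphProductWeights
import HarnessLib

/-!
# Quantum expander codes: the parameters `[[n_A² + n_B², ≥ (n_A − n_B)², ≥ min(d, dᵀ)]]` and the
# expansion distance bound `D > min(γ_A n_A, γ_B n_B)` (Leverrier–Tillich–Zémor 2015, §2 eq. (4),
# Lemma 3, Proposition 4, Corollary 5; Sipser–Spielman 1996) — PROOFS

Topic `Literature/InformationTheory/QuantumCodes` (venture QEC, LADDER-QEC rung Q3: hypergraph-product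
parameter theorems). A. Leverrier, J.-P. Tillich, G. Zémor, *Quantum expander codes*, FOCS 2015,
arXiv:1504.00822 (held text `paper:arxiv-1504.00822`, v1; locators below are its chunks), §2 and §4.
This file is def-free: it PROVES, over the objects of `QuantumExpanderCodes.lean` (the biadjacency /
parity-check matrix `H : Matrix B A (ZMod 2)` of the bipartite graph `G = (A ∪ B, ℰ)`, `leftNbhd`,
`IsLeftExpanding`, `IsRightExpanding`, `IsLeftRightExpanding`, `IsBiregular`, and the check matrices
`expanderHX H = HypergraphProduct.zMatrix H Hᵀ`, `expanderHZ H = HypergraphProduct.xMatrix H Hᵀ` of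
the quantum expander code `Q_G`) and with the tree's Tillich–Zémor library (`HypergraphProduct*.lean`):

* **§2 eq. (4), the parameters of `Q_G`** ("It is proved furthermore in [TZ14] that the parameters of
  the quantum code `Q_G = (C_X, C_Z)` are `[[n = n_A² + n_B², k ≥ (n_A − n_B)², min(d, dᵀ)]]` where `d`
  denotes the minimum distance of the classical code `C_G` … and `dᵀ` stands for the associated
  transpose minimum distance … each of these respective minima is set to equal `∞` if there are no
  subsets of columns, or rows respectively, that sum to zero", p0005 L80-90): `card_qubits`
  (`n = n_A² + n_B²`), `dimension_eq` (`n − rank H_X − rank H_Z = κ² + (κᵀ)²` with `κ = dim ker H`,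
  `κᵀ = dim ker Hᵀ`, from TZ Props 5/6) and `dimension_ge` (`≥ (n_A − n_B)²`, since
  `κ − κᵀ = n_A − n_B` by rank–nullity), `min_minDist_le_cssMinDist` (`D ≥ min(d, dᵀ)`, TZ Thm 9 for
  `ℋ₁ = H`, `ℋ₂ = Hᵀ`), the LDPC clause "constant row weight `Δ_A + Δ_B`" (p0005 L77-78) as
  `hammingNorm_expanderHX_row_le` / `hammingNorm_expanderHZ_row_le`, the biregular edge count
  `n_A Δ_A = n_B Δ_B` (`card_mul_eq_card_mul_of_isBiregular`) and the rate remark "bounded from below by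
  a non-zero constant" with the explicit constant `(1 − Δ_A/Δ_B)²/(1 + (Δ_A/Δ_B)²)`
  (`rate_mul_card_le_dimension`, p0006 L3-5); bundled as `LTZ15_parameters`.
* **Lemma 3** (= Sipser–Spielman 1996, unique-neighbour expansion; p0008 L13-27): if `G` is
  `(γ_A, δ_A)`-left-expanding (left degrees `≤ Δ_A`) then every `S ⊆ A` with `|S| ≤ γ_A n_A` has at
  least `(1 − 2δ_A) Δ_A |S|` unique neighbours (checks met exactly once by `S`): `card_uniqueNbhd_ge`.
* **Proposition 4** (= Sipser–Spielman 1996; p0008 L34-35: "the minimum distance `d` of the associated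
  classical code `C_G` is at least `γ_A n_A`" when `δ_A < 1/2`) is NOT re-proved here: it is the tree's
  `hammingNorm_gt_of_isLeftExpanding` / `le_minDist_pcCode_of_isLeftExpanding`
  (`ExpanderCodeDistance.lean`, qec-type-07, via Richardson–Urbanke Thm 8.2), imported.
* **Corollary 5** (p0008 L40-45): if `G` is `(γ_A, δ_A, γ_B, δ_B)`-left-right-expanding with
  `δ_A, δ_B < 1/2` (degrees `Δ_A, Δ_B ≥ 1`) then "the minimum distance of the associated quantum code
  `Q_G` is at least `min(γ_A n_A, γ_B n_B)`": `floor_succ_le_cssMinDist`.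

Honest framing. (i) The degree side conditions `0 < Δ_A`, `0 < Δ_B` are implicit in the source (a
biregular graph with edges); they are NECESSARY: for `H = 0` every expansion inequality holds
vacuously (`(1 − δ)·0·|S| ≤ 0`) while `ker H` contains weight-one words. We assume only UPPER degree
bounds (`≤ Δ`), which is what the counting uses; `IsBiregular` versions are corollaries. (ii) The
distance bounds are STRICT (`weight > min(γ_A n_A, γ_B n_B)`, typed as `⌊·⌋ + 1 ≤ D` in `ℕ∞`); the
printed "at least" follows. (iii) Nothing here touches the four statement-only facts of `QuantumExpanderCodes.lean`
(`LTZ15_theorem2`, `FGL18_proposition11`, `FGL18_theorem1`, `FGL18_theorem17` — the decoder and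
threshold statements), which remain as filed there.

References: [LeverrierTillichZemor2015] arXiv:1504.00822 = FOCS 2015, doi:10.1109/focs.2015.55;
[SipserSpielman1996] M. Sipser, D. A. Spielman, *Expander codes*, IEEE Trans. Inform. Theory 42 (1996)
1710–1722 (the source LTZ15 quotes for Lemma 3 / Prop. 4); [TillichZemor2014] arXiv:0903.0566 (Thm 7,
Thm 9, Props 5–6, proved in the tree: `HypergraphProductDimension.lean`, `HypergraphProductDistance.lean`).
-/

namespace Literature.InformationTheory.QuantumCodes

namespace QuantumExpander

open Finset Matrix

variable {A B : Type*} [Fintype A] [Fintype B]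

/-! ### Unique-neighbour expansion (LTZ15 Lemma 3 = Sipser–Spielman) -/

omit [Fintype A] in
/-- Double counting of the edges leaving `S ⊆ A`: summing over the checks `b` the number of neighbours of
`b` inside `S` gives the sum of the (left) degrees of the vertices of `S` ("The number of edges incident
to `S_A` should coincide with the number of edges incident to `Γ(S_A)`").
[cite: LeverrierTillichZemor2015, proof of Lemma 3 (arXiv v1 p0008 L20-24)] -/
theorem sum_card_nbhd_inter_eq (H : Matrix B A (ZMod 2)) (S : Finset A) :
    ∑ b, (S.filter fun a => H b a ≠ 0).card
      = ∑ a ∈ S, (univ.filter fun b : B => H b a ≠ 0).card := by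
  simp only [Finset.card_filter]
  exact Finset.sum_comm

/-- Edge count of a biregular graph: `n_A Δ_A = |ℰ| = n_B Δ_B` (so `n_B/n_A = Δ_A/Δ_B`, the ratio behind
"the rate of the quantum code `Q_G` is bounded from below by a non-zero constant" together with
`dimension_ge`). [cite: LeverrierTillichZemor2015, §2 (biregular graphs; arXiv v1 p0005 L5-8, p0006 L3-5)] -/
theorem card_mul_eq_card_mul_of_isBiregular (H : Matrix B A (ZMod 2)) {dA dB : ℕ}
    (hreg : IsBiregular H dA dB) : Fintype.card A * dA = Fintype.card B * dB := by
  classical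
  have h := sum_card_nbhd_inter_eq H (univ : Finset A)
  simp only [hreg.1, hreg.2, Finset.sum_const, Finset.card_univ, smul_eq_mul] at h
  exact h.symm

omit [Fintype A] in
/-- The neighbourhood `Γ(S)` is the set of checks with at least one neighbour in `S`.
[cite: LeverrierTillichZemor2015, §2 (Γ(S); arXiv v1 p0005 L12)] -/
theorem leftNbhd_eq_filter_card_pos (H : Matrix B A (ZMod 2)) (S : Finset A) :
    leftNbhd H S = univ.filter fun b : B => 1 ≤ (S.filter fun a => H b a ≠ 0).card := by
  ext b
  simp only [leftNbhd, Finset.mem_filter, Finset.mem_univ, true_and, Nat.one_le_iff_ne_zero, ne_eq,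
    Finset.card_eq_zero, Finset.filter_eq_empty_iff, not_forall, not_not, exists_prop]

/-- **LTZ15 Lemma 3 (Sipser–Spielman unique-neighbour expansion).** "Let `G = (A ∪ B, ℰ)` be a
`(γ_A, δ_A)`-left-expanding graph with `δ_A < 1/2`. Then, for any subset `S_A ⊆ A` with `|S_A| ≤ γ_A n_A`,
we have `|Γ_u(S_A)| ≥ (1 − 2δ_A) Δ_A |S_A|`", where `Γ_u(S)` is the set of unique neighbours of `S` — the
checks `b` having exactly one neighbour in `S` (written here as that filter; no new definition). Proved
by the printed double counting; only the UPPER degree bound `deg(a) ≤ Δ_A` is used, and `δ_A < 1/2` is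
not needed for the inequality itself (it makes the bound positive).
[cite: LeverrierTillichZemor2015, Lemma 3 (arXiv v1 p0008 L13-27)] [cite: SipserSpielman1996, unique-neighbour lemma (quoted by LTZ15 as [SS96])] -/
theorem card_uniqueNbhd_ge (H : Matrix B A (ZMod 2)) {dA : ℕ} {γ δ : ℝ}
    (hdeg : ∀ a : A, (univ.filter fun b : B => H b a ≠ 0).card ≤ dA)
    (hexp : IsLeftExpanding H dA γ δ) (S : Finset A) (hS : (S.card : ℝ) ≤ γ * Fintype.card A) :
    (1 - 2 * δ) * dA * S.card
      ≤ ((univ.filter fun b : B => (S.filter fun a => H b a ≠ 0).card = 1).card : ℝ) := by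
  classical
  -- `m b` = number of neighbours of the check `b` inside `S`
  set m : B → ℕ := fun b => (S.filter fun a => H b a ≠ 0).card with hm
  -- (i) the number of edges leaving `S` is at most `Δ_A |S|`
  have hE : ∑ b, m b ≤ S.card * dA := by
    calc ∑ b, m b = ∑ a ∈ S, (univ.filter fun b : B => H b a ≠ 0).card := sum_card_nbhd_inter_eq H S
      _ ≤ ∑ a ∈ S, dA := Finset.sum_le_sum fun a _ => hdeg a
      _ = S.card * dA := by rw [Finset.sum_const, smul_eq_mul]
  -- (ii) unique neighbours count once, multiple neighbours at least twice
  have hU : (univ.filter fun b : B => m b = 1).card = ∑ b, if m b = 1 then 1 else 0 := by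
    rw [Finset.card_filter]
  have hM : (univ.filter fun b : B => 2 ≤ m b).card = ∑ b, if 2 ≤ m b then 1 else 0 := by
    rw [Finset.card_filter]
  have hG : (leftNbhd H S).card = ∑ b, if 1 ≤ m b then 1 else 0 := by
    rw [leftNbhd_eq_filter_card_pos, Finset.card_filter]
  have p1 : ∀ k : ℕ, (if k = 1 then 1 else 0) + 2 * (if 2 ≤ k then 1 else 0) ≤ k := by
    intro k; split_ifs <;> omega
  have p2 : ∀ k : ℕ, (if 1 ≤ k then 1 else 0) = (if k = 1 then 1 else 0) + (if 2 ≤ k then 1 else 0) := by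
    intro k; split_ifs <;> omega
  have hUM : (univ.filter fun b : B => m b = 1).card + 2 * (univ.filter fun b : B => 2 ≤ m b).card
      ≤ ∑ b, m b := by
    rw [hU, hM, Finset.mul_sum, ← Finset.sum_add_distrib]
    exact Finset.sum_le_sum fun b _ => p1 (m b)
  have hGUM : (leftNbhd H S).card
      = (univ.filter fun b : B => m b = 1).card + (univ.filter fun b : B => 2 ≤ m b).card := by
    rw [hG, hU, hM, ← Finset.sum_add_distrib]
    exact Finset.sum_congr rfl fun b _ => p2 (m b)
  -- (iii) expansion, and combine over `ℝ`
  have hX := hexp S hS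
  have hE' : ((∑ b, m b : ℕ) : ℝ) ≤ (S.card : ℝ) * dA := by exact_mod_cast hE
  have hUM' : ((univ.filter fun b : B => m b = 1).card : ℝ)
      + 2 * ((univ.filter fun b : B => 2 ≤ m b).card : ℝ) ≤ ((∑ b, m b : ℕ) : ℝ) := by
    exact_mod_cast hUM
  have hGUM' : ((leftNbhd H S).card : ℝ)
      = ((univ.filter fun b : B => m b = 1).card : ℝ) + ((univ.filter fun b : B => 2 ≤ m b).card : ℝ) := by
    exact_mod_cast hGUM
  have hδsplit : (1 - 2 * δ) * dA * S.card = 2 * ((1 - δ) * dA * S.card) - dA * S.card := by ring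
  rw [hδsplit]
  linarith

/-- **LTZ15 Lemma 3** under the printed biregularity hypothesis (left degree exactly `Δ_A`).
[cite: LeverrierTillichZemor2015, Lemma 3 (arXiv v1 p0008 L13-27)] -/
theorem card_uniqueNbhd_ge_of_isBiregular (H : Matrix B A (ZMod 2)) {dA dB : ℕ} {γ δ : ℝ}
    (hreg : IsBiregular H dA dB) (hexp : IsLeftExpanding H dA γ δ) (S : Finset A)
    (hS : (S.card : ℝ) ≤ γ * Fintype.card A) :
    (1 - 2 * δ) * dA * S.card
      ≤ ((univ.filter fun b : B => (S.filter fun a => H b a ≠ 0).card = 1).card : ℝ) :=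
  card_uniqueNbhd_ge H (fun a => (hreg.1 a).le) hexp S hS

/-! ### Left expansion of the reversed graph `Hᵀ` is right expansion of `H` -/

omit [Fintype B] in
/-- The neighbourhood of a set of checks in `G` is its left neighbourhood in the reversed graph `Hᵀ`.
[cite: LeverrierTillichZemor2015, §2 (arXiv v1 p0005 L9-18)] -/
theorem leftNbhd_transpose (H : Matrix B A (ZMod 2)) (T : Finset B) :
    leftNbhd Hᵀ T = rightNbhd H T := by
  ext a
  simp [leftNbhd, rightNbhd]

/-- `(γ_B, δ_B)`-right expansion of `G` is `(γ_B, δ_B)`-left expansion of the reversed graph ("by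
inverting the roles of `A` and `B`"). [cite: LeverrierTillichZemor2015, §2 and proof of Cor. 5 (arXiv v1 p0005 L9-18, p0008 L43-45)] -/
theorem isLeftExpanding_transpose_iff (H : Matrix B A (ZMod 2)) (dB : ℕ) (γ δ : ℝ) :
    IsLeftExpanding Hᵀ dB γ δ ↔ IsRightExpanding H dB γ δ := by
  simp only [IsLeftExpanding, IsRightExpanding, leftNbhd_transpose]

/-! ### The parameters of `Q_G` (LTZ15 §2 eq. (4), from Tillich–Zémor) -/

/-- **Length of `Q_G`:** `n = n_A² + n_B²` (qubits `A² ∪ B²`).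
[cite: LeverrierTillichZemor2015, §2 eq. (4) (arXiv v1 p0005 L83)] -/
theorem card_qubits : Fintype.card ((A × A) ⊕ (B × B)) = Fintype.card A ^ 2 + Fintype.card B ^ 2 := by
  rw [Fintype.card_sum, Fintype.card_prod, Fintype.card_prod, sq, sq]

variable [DecidableEq A] [DecidableEq B]

/-- **Dimension of `Q_G`, exact form:** `n − rank H_X − rank H_Z = κ² + (κᵀ)²` with `κ = dim ker H = dim C_G`
and `κᵀ = dim ker Hᵀ`. (TZ Thm 7 for `ℋ₁ = H`, `ℋ₂ = Hᵀ` reads `dim Q = 2κκᵀ + κᵀ(n_B − n_A) + κ(n_A − n_B)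
= 2κκᵀ + (κ − κᵀ)(n_A − n_B)`, and rank–nullity `rank H + κ = n_A`, `rank H + κᵀ = n_B` gives
`κ − κᵀ = n_A − n_B`, whence `κ² + (κᵀ)²`; proved here directly from TZ Props 5–6 in rank form.) Over `ℤ`
(no truncated subtraction).
[cite: LeverrierTillichZemor2015, §2 eq. (4) (arXiv v1 p0005 L80-84)] [cite: TillichZemor2014, Thm 7 and Props 5-6 (arXiv v1 chunk p0007 L66-135)] -/
theorem dimension_eq (H : Matrix B A (ZMod 2)) :
    (Fintype.card ((A × A) ⊕ (B × B)) : ℤ) - (expanderHX H).rank - (expanderHZ H).rank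
      = (Module.finrank (ZMod 2) (pcCode H) : ℤ) ^ 2
        + (Module.finrank (ZMod 2) (pcCode Hᵀ) : ℤ) ^ 2 := by
  have hX := congrArg (Nat.cast : ℕ → ℤ) (HypergraphProduct.rank_zMatrix_add H Hᵀ)
  have hZ := congrArg (Nat.cast : ℕ → ℤ) (HypergraphProduct.rank_xMatrix_add H Hᵀ)
  have h1 := congrArg (Nat.cast : ℕ → ℤ) (HypergraphProduct.rank_add_finrank_pcCode H)
  have h2 := congrArg (Nat.cast : ℕ → ℤ) (HypergraphProduct.rank_add_finrank_pcCode Hᵀ)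
  rw [Matrix.transpose_transpose] at hZ
  rw [Matrix.rank_transpose] at h2
  push_cast at hX hZ h1 h2
  have hc : (Fintype.card ((A × A) ⊕ (B × B)) : ℤ)
      = (Fintype.card A : ℤ) * Fintype.card A + (Fintype.card B : ℤ) * Fintype.card B := by
    rw [Fintype.card_sum, Fintype.card_prod, Fintype.card_prod]; push_cast; ring
  change (Fintype.card ((A × A) ⊕ (B × B)) : ℤ) - ((HypergraphProduct.zMatrix H Hᵀ).rank : ℤ)
      - ((HypergraphProduct.xMatrix H Hᵀ).rank : ℤ) = _
  linear_combination hc - hX - hZ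
    - ((Module.finrank (ZMod 2) (pcCode H) : ℤ) - (Module.finrank (ZMod 2) (pcCode Hᵀ) : ℤ)
        + (Fintype.card A : ℤ) - (Fintype.card B : ℤ)) * (h1 - h2)

/-- **Dimension of `Q_G`, printed bound:** "`k ≥ (n_A − n_B)²`" — `n − rank H_X − rank H_Z ≥ (n_A − n_B)²`
(`= (κ − κᵀ)² ≤ κ² + (κᵀ)²`). [cite: LeverrierTillichZemor2015, §2 eq. (4) (arXiv v1 p0005 L83)] -/
theorem dimension_ge (H : Matrix B A (ZMod 2)) :
    ((Fintype.card A : ℤ) - Fintype.card B) ^ 2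
      ≤ (Fintype.card ((A × A) ⊕ (B × B)) : ℤ) - (expanderHX H).rank - (expanderHZ H).rank := by
  rw [dimension_eq]
  have h1 := congrArg (Nat.cast : ℕ → ℤ) (HypergraphProduct.rank_add_finrank_pcCode H)
  have h2 := congrArg (Nat.cast : ℕ → ℤ) (HypergraphProduct.rank_add_finrank_pcCode Hᵀ)
  rw [Matrix.rank_transpose] at h2
  push_cast at h1 h2
  have hκ : (0 : ℤ) ≤ Module.finrank (ZMod 2) (pcCode H) := Nat.cast_nonneg _
  have hτ : (0 : ℤ) ≤ Module.finrank (ZMod 2) (pcCode Hᵀ) := Nat.cast_nonneg _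
  have hdiff : (Fintype.card A : ℤ) - Fintype.card B
      = (Module.finrank (ZMod 2) (pcCode H) : ℤ) - Module.finrank (ZMod 2) (pcCode Hᵀ) := by
    linear_combination h2 - h1
  rw [hdiff]
  nlinarith [mul_nonneg hκ hτ]

/-- **Rate of `Q_G` in a biregular graph, printed remark:** "the rate of the quantum code `Q_G` is bounded
from below by a non-zero constant" — for a `(Δ_A, Δ_B)`-biregular `G` (`Δ_B ≥ 1`) the edge count
`n_A Δ_A = n_B Δ_B` turns `k ≥ (n_A − n_B)²` into `k ≥ R · n` with the explicit constant
`R = (1 − Δ_A/Δ_B)² / (1 + (Δ_A/Δ_B)²)` and `n = n_A² + n_B²` (non-zero iff `Δ_A ≠ Δ_B`).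
[cite: LeverrierTillichZemor2015, §2 (arXiv v1 p0005 L83, p0006 L3-5)] -/
theorem rate_mul_card_le_dimension (H : Matrix B A (ZMod 2)) {dA dB : ℕ} (hreg : IsBiregular H dA dB)
    (hdB : 0 < dB) :
    (1 - (dA : ℝ) / dB) ^ 2 / (1 + ((dA : ℝ) / dB) ^ 2) * (Fintype.card ((A × A) ⊕ (B × B)) : ℝ)
      ≤ (((Fintype.card ((A × A) ⊕ (B × B)) : ℤ) - (expanderHX H).rank - (expanderHZ H).rank : ℤ) : ℝ) := by
  have hk := dimension_ge H
  have hcount := card_mul_eq_card_mul_of_isBiregular H hreg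
  have hdB' : (dB : ℝ) ≠ 0 := by exact_mod_cast hdB.ne'
  have hB : (Fintype.card B : ℝ) = (Fintype.card A : ℝ) * dA / dB := by
    field_simp
    exact_mod_cast hcount.symm
  have hQ : (Fintype.card ((A × A) ⊕ (B × B)) : ℝ)
      = (1 + ((dA : ℝ) / dB) ^ 2) * (Fintype.card A : ℝ) ^ 2 := by
    rw [card_qubits]; push_cast; rw [hB]; field_simp
  have hk' : ((((Fintype.card A : ℤ) - Fintype.card B) ^ 2 : ℤ) : ℝ)
      ≤ (((Fintype.card ((A × A) ⊕ (B × B)) : ℤ) - (expanderHX H).rank - (expanderHZ H).rank : ℤ) : ℝ) := by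
    exact_mod_cast hk
  have hsq : ((((Fintype.card A : ℤ) - Fintype.card B) ^ 2 : ℤ) : ℝ)
      = (1 - (dA : ℝ) / dB) ^ 2 * (Fintype.card A : ℝ) ^ 2 := by
    push_cast; rw [hB]; field_simp
  have hpos : (0 : ℝ) < 1 + ((dA : ℝ) / dB) ^ 2 := by positivity
  calc (1 - (dA : ℝ) / dB) ^ 2 / (1 + ((dA : ℝ) / dB) ^ 2) * (Fintype.card ((A × A) ⊕ (B × B)) : ℝ)
      = (1 - (dA : ℝ) / dB) ^ 2 * (Fintype.card A : ℝ) ^ 2 := by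
        rw [hQ]; field_simp
    _ = ((((Fintype.card A : ℤ) - Fintype.card B) ^ 2 : ℤ) : ℝ) := hsq.symm
    _ ≤ _ := hk'

/-- **Minimum distance of `Q_G`, printed form:** `D ≥ min(d, dᵀ)` with `d = d(ker H)` the minimum distance of
`C_G` and `dᵀ = d(ker Hᵀ)` the transpose minimum distance (both `⊤` for the zero code) — Tillich–Zémor's
Theorem 9 `D ≥ min(d₁, d₂, d₁ᵀ, d₂ᵀ)` for `ℋ₁ = H`, `ℋ₂ = Hᵀ` (so `{d₁, d₂ᵀ} = {d}`, `{d₂, d₁ᵀ} = {dᵀ}`), read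
for the CSS pair `(expanderHX H, expanderHZ H) = (H_Z, H_X)` of the tree's product via `cssMinDist_comm`.
[cite: LeverrierTillichZemor2015, §2 eq. (4) (arXiv v1 p0005 L80-90)] [cite: TillichZemor2014, Thm 9 (arXiv v1 chunk p0008 L11-15)] -/
theorem min_minDist_le_cssMinDist (H : Matrix B A (ZMod 2)) :
    min (Coding.minDist (pcCode H)) (Coding.minDist (pcCode Hᵀ))
      ≤ cssMinDist (expanderHX H) (expanderHZ H) := by
  change _ ≤ cssMinDist (HypergraphProduct.zMatrix H Hᵀ) (HypergraphProduct.xMatrix H Hᵀ)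
  rw [cssMinDist_comm]
  refine le_cssMinDist_iff.2 fun e he => ?_
  rcases he with ⟨hX, hZ⟩ | ⟨hZ, hX⟩
  · exact HypergraphProduct.min_le_hammingNorm_of_cycle H Hᵀ hX hZ
  · have h := HypergraphProduct.min_le_hammingNorm_of_cocycle H Hᵀ hZ hX
    rw [Matrix.transpose_transpose, min_comm] at h
    exact h

/-- **Row weights of `H_X` of `Q_G`** ("the parity-check matrices `H_X` and `H_Z` are low density, with
constant row weight `Δ_A + Δ_B`"): for a `(Δ_A, Δ_B)`-biregular graph every row of `expanderHX H` (the
check `αβ ∈ A × B`) has weight `≤ Δ_A + Δ_B`.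
[cite: LeverrierTillichZemor2015, §2 (arXiv v1 p0005 L77-78)] [cite: TillichZemor2014, §4 (row weights `i+j`)] -/
theorem hammingNorm_expanderHX_row_le (H : Matrix B A (ZMod 2)) {dA dB : ℕ} (hreg : IsBiregular H dA dB)
    (α : A) (β : B) : hammingNorm (expanderHX H (α, β)) ≤ dA + dB := by
  have h := HypergraphProduct.hammingNorm_zMatrix_row_le H Hᵀ α β
  have e1 : hammingNorm (fun b : B => H b α) = dA := by simpa [hammingNorm] using hreg.1 α
  have e2 : hammingNorm (fun a : A => Hᵀ a β) = dB := by simpa [hammingNorm] using hreg.2 β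
  rw [e1, e2] at h
  exact h

/-- **Row weights of `H_Z` of `Q_G`**: for a `(Δ_A, Δ_B)`-biregular graph every generator `g_{ba}` (row
`ba ∈ B × A` of `expanderHZ H`) has weight `≤ Δ_A + Δ_B` (`|g_{ba}| = Δ_B + Δ_A`).
[cite: LeverrierTillichZemor2015, §2 (arXiv v1 p0005 L77-78) and §3 eq. (g_ba) (p0007)] [cite: TillichZemor2014, §4 (row weights `i+j`)] -/
theorem hammingNorm_expanderHZ_row_le (H : Matrix B A (ZMod 2)) {dA dB : ℕ} (hreg : IsBiregular H dA dB)
    (b : B) (a : A) : hammingNorm (expanderHZ H (b, a)) ≤ dA + dB := by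
  have h := HypergraphProduct.hammingNorm_xMatrix_row_le H Hᵀ b a
  have e1 : hammingNorm (H b) = dB := by simpa [hammingNorm] using hreg.2 b
  have e2 : hammingNorm (Hᵀ a) = dA := by
    have := hreg.1 a
    simpa [hammingNorm, Matrix.transpose] using this
  rw [e1, e2, add_comm] at h
  exact h

/-- **LTZ15 §2 eq. (4) — the parameters `[[n = n_A² + n_B², k ≥ (n_A − n_B)², min(d, dᵀ)]]` of the quantum
expander code `Q_G`**, the three clauses together (length; dimension `n − rank H_X − rank H_Z` over `ℤ`;
distance lower bound in `ℕ∞`). PROVED (Tillich–Zémor Thms 7 and 9, in the tree).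
[cite: LeverrierTillichZemor2015, §2 eq. (4) (arXiv v1 p0005 L80-90)] [cite: TillichZemor2014, Thm 7, Thm 9] -/
theorem LTZ15_parameters (H : Matrix B A (ZMod 2)) :
    Fintype.card ((A × A) ⊕ (B × B)) = Fintype.card A ^ 2 + Fintype.card B ^ 2
    ∧ ((Fintype.card A : ℤ) - Fintype.card B) ^ 2
        ≤ (Fintype.card ((A × A) ⊕ (B × B)) : ℤ) - (expanderHX H).rank - (expanderHZ H).rank
    ∧ min (Coding.minDist (pcCode H)) (Coding.minDist (pcCode Hᵀ))
        ≤ cssMinDist (expanderHX H) (expanderHZ H) :=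
  ⟨card_qubits, dimension_ge H, min_minDist_le_cssMinDist H⟩

/-! ### Expansion ⇒ quantum minimum distance (LTZ15 Corollary 5) -/

/-- **LTZ15 Corollary 5.** "If the graph `G = (A ∪ B, ℰ)` is `(γ_A, δ_A, γ_B, δ_B)`-left-right-expanding with
`δ_A, δ_B < 1/2`, then the minimum distance of the associated quantum code `Q_G` is at least
`min(γ_A n_A, γ_B n_B)`." Typed: `D ≥ ⌊min(γ_A n_A, γ_B n_B)⌋ + 1`, i.e. every logical operator has weight
`> min(γ_A n_A, γ_B n_B)`. Hypotheses: degree bounds `deg(a) ≤ Δ_A`, `deg(b) ≤ Δ_B` with `Δ_A, Δ_B ≥ 1`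
(see the module docstring for why `Δ = 0` must be excluded). Proof as printed: Prop. 4 (the tree's
`le_minDist_pcCode_of_isLeftExpanding`) for `G` and for the reversed graph `Hᵀ`, then eq. (4).
[cite: LeverrierTillichZemor2015, Cor. 5 (arXiv v1 p0008 L40-45)] -/
theorem floor_succ_le_cssMinDist (H : Matrix B A (ZMod 2)) {dA dB : ℕ} {γA δA γB δB : ℝ}
    (hdegA : ∀ a : A, (univ.filter fun b : B => H b a ≠ 0).card ≤ dA)
    (hdegB : ∀ b : B, (univ.filter fun a : A => H b a ≠ 0).card ≤ dB)
    (hdA : 0 < dA) (hdB : 0 < dB)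
    (hexp : IsLeftRightExpanding H dA dB γA δA γB δB) (hδA : δA < 1 / 2) (hδB : δB < 1 / 2) :
    ((⌊min (γA * Fintype.card A) (γB * Fintype.card B)⌋₊ + 1 : ℕ) : ℕ∞)
      ≤ cssMinDist (expanderHX H) (expanderHZ H) := by
  have hA := le_minDist_pcCode_of_isLeftExpanding H hdA hdegA hexp.1 hδA
  have hdegB' : ∀ b : B, (univ.filter fun a : A => Hᵀ a b ≠ 0).card ≤ dB := fun b => by
    simpa [Matrix.transpose] using hdegB b
  have hB := le_minDist_pcCode_of_isLeftExpanding Hᵀ hdB hdegB'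
    ((isLeftExpanding_transpose_iff H dB γB δB).2 hexp.2) hδB
  have hmA : ⌊min (γA * Fintype.card A) (γB * Fintype.card B)⌋₊ + 1 ≤ ⌊γA * Fintype.card A⌋₊ + 1 :=
    Nat.succ_le_succ (Nat.floor_mono (min_le_left _ _))
  have hmB : ⌊min (γA * Fintype.card A) (γB * Fintype.card B)⌋₊ + 1 ≤ ⌊γB * Fintype.card B⌋₊ + 1 :=
    Nat.succ_le_succ (Nat.floor_mono (min_le_right _ _))
  have hmin : ((⌊min (γA * Fintype.card A) (γB * Fintype.card B)⌋₊ + 1 : ℕ) : ℕ∞)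
      ≤ min (Coding.minDist (pcCode H)) (Coding.minDist (pcCode Hᵀ)) :=
    le_min ((Nat.cast_le.2 hmA).trans hA) ((Nat.cast_le.2 hmB).trans hB)
  exact hmin.trans (min_minDist_le_cssMinDist H)

/-- **LTZ15 Corollary 5, weight form under the printed biregularity hypothesis:** for a
`(Δ_A, Δ_B)`-biregular (`Δ_A, Δ_B ≥ 1`) `(γ_A, δ_A, γ_B, δ_B)`-left-right-expanding graph with
`δ_A, δ_B < 1/2`, every logical operator of `Q_G` — a vector of `ker H_X ∖ rowsp H_Z` or of
`ker H_Z ∖ rowsp H_X` (for either labelling of the two check matrices) — has weight `> min(γ_A n_A, γ_B n_B)`.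
[cite: LeverrierTillichZemor2015, Cor. 5 (arXiv v1 p0008 L40-45)] -/
theorem min_lt_hammingNorm_of_isBiregular (H : Matrix B A (ZMod 2)) {dA dB : ℕ} {γA δA γB δB : ℝ}
    (hreg : IsBiregular H dA dB) (hdA : 0 < dA) (hdB : 0 < dB)
    (hexp : IsLeftRightExpanding H dA dB γA δA γB δB) (hδA : δA < 1 / 2) (hδB : δB < 1 / 2)
    {e : (A × A) ⊕ (B × B) → ZMod 2}
    (he : (e ∈ pcCode (expanderHX H) ∧ e ∉ rowSpace (expanderHZ H))
      ∨ (e ∈ pcCode (expanderHZ H) ∧ e ∉ rowSpace (expanderHX H))) :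
    min (γA * Fintype.card A) (γB * Fintype.card B) < hammingNorm e := by
  have h := (floor_succ_le_cssMinDist H (fun a => (hreg.1 a).le) (fun b => (hreg.2 b).le) hdA hdB hexp
    hδA hδB).trans (cssMinDist_le_hammingNorm he)
  have h' : ⌊min (γA * Fintype.card A) (γB * Fintype.card B)⌋₊ + 1 ≤ hammingNorm e := by
    exact_mod_cast h
  exact Nat.lt_of_floor_lt (Nat.lt_of_succ_le h')

end QuantumExpander

end Literature.InformationTheory.QuantumCodes
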